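/-
Copyright (c) 2026 the pub-hodgecm-mathlib formalisation cell (harness21).  Prover seat hodgecm-mathlib-K2E2-p12 (g7), Track B «K2-LIT» ∕ h413 = stmt-HodgeConjecture-24833,
line `K2_E3_EllipticInputs`, unit U12 «Characters», L4 EMIT #4 corner (11-3ns-res) (MAIN :945 `sig_K2E3CharLocIntNearSemisimpleResidualThree`), deal D157 of the LINE-LEAD K2E3-plan (g4)
2026-09-04T15:14:23Z: the ANALYTIC PAYER (ps-rep)₃ — the character of the induced MODULE `i_G(χ) = cmPrincipalSeries L 3 v χ` of `U(Φ₃)(L⁺_v)` (`v` non-split), reducible or not, is an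
integrable function near EVERY point (in particular near every semisimple `s`).
-/
import Summits.HodgeConjecture.HodgeConjecture.Theorems.K2E3CharLocIntPrincipalSeriesThree   -- ★ K2E3-p11 (g3), road (11-PS) FILE 3: `exists_locallyIntegrable_smoothTrace_cmPrincipalSeries_eq` (van Dijk ∕ HC Thm. 16.1 for the MODULE `i_G(χ)`)
import HarnessLib

/-!
# K2_E3 (h413), unit U12 «Characters», corner (11-3ns-res) — deal D157: THE (ps-rep)₃ PAYER `K2E3CharLocIntNearSemisimpleCmPrincipalSeriesThree` —
# THE CHARACTER OF THE INDUCED MODULE `cmPrincipalSeries L 3 v χ` OF `U(Φ₃)(L⁺_v)` (`v` NON-SPLIT, `χ` CONTINUOUS, REDUCIBLE OR NOT) IS AN INTEGRABLE FUNCTION NEAR EVERY `s`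

Cell `pub/hodgecm-mathlib`, Track B «K2-LIT», lane `--supports stmt-HodgeConjecture-24833 --as helper` (count-neutral); THEOREMS ONLY (no `def`, no instance, no notation, no named fact,
no `sorry`; default heartbeats).  LINE-LEAD K2E3-plan (g4) L4 EMIT #4 (2026-09-04T15:13:07Z): the (11-3ns-res) corner «the residual classes» (Rogawski §12.2 (2)(3)) is cut as
`residualThree_of_cut (hrep₃) (hJH) (hCI…) (hHCD)` (K2E1-p12 (g3), D156); THIS FILE pays **`hrep₃`** = «the character of `cmPrincipalSeries L 3 v χ` is `L¹` near every `s`» — the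
`N = 3` twin of the `hrep` binder of ★ p860946 `K2E3CharLocIntNearIdentityResidualQuasiSplitTwoOfCut.charLocIntNearIdentityResidual_of_cut` (architect K2E3-p25 (g3) freezes the bytes
in PART «RES3»; the heads below are typed so that the tie is `exact` or an η-expansion).

THE MATHEMATICS ([Rogawski1990, §4.9 (4.9.4) p. 56, §12.5 p. 182]; [vanDijk1972, Thm. p. 237]; [HarishChandra1999, Thm. 16.1 p. 77]).  Van Dijk's theorem computes the character
of the INDUCED MODULE `i_G(χ)` — irreducible or not — as the locally integrable class function `Θ_χ = (χ + χ∘ʷ)∕D_G` on the regular hyperbolic set (`0` off it), representing the trace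
on ALL of `C_c^∞(G)`; this is ★ `K2E3CharLocIntPrincipalSeriesThree.exists_locallyIntegrable_smoothTrace_cmPrincipalSeries_eq` (K2E3-p11 (g3)), whose statement is about the module
`cmPrincipalSeries L 3 v χ` and uses NO irreducibility (★ §5 there spends an equivalence only to pass to an irreducible CLASS).  Hence at EVERY `s ∈ G` (semisimple or not): with `K` a
compact neighbourhood of `s` and `U := interior K`, `Θ_χ|_U` is integrable and `Tr i_G(χ)(f) = ∫ f·Θ_χ` for every `f ∈ C_c^∞(G)` supported in `U` — §5's three lines WITHOUT the class.
WHAT USED IRREDUCIBILITY: NOTHING (the R0 question of the deal).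
* §1 **`charLocIntNear_cmPrincipalSeries_three`** — the strong form at EVERY `s` (binders `hns μ χ hχ s`).
* §2 **`sig_shape_cmPrincipalSeries_three`** — the ∀-CLOSED socket shape: ★ p860946's `hrep` bytes with `2 ↦ 3` in the `Gqs L v` spelling of MAIN :945 and MAIN :953's semisimplicity
  binder inserted after `∀ s` (it is not used).
HONEST LABEL: HC_CM is proved only modulo the 7 printed citations (2 remaining named inputs: hLiu418 = `stmt-HodgeConjecture-24832`, h413 = `stmt-HodgeConjecture-24833`) until rung 0
closes; count-neutral helper: pays the analytic letter `hrep₃` of the (11-3ns-res) reduction; the corner stays OPEN on its S-layer letters (res3-CI-k); closes no socket.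

## References
* [Rogawski1990] J. D. Rogawski, *Automorphic Representations of Unitary Groups in Three Variables*, Ann. of Math. Stud. 123 (1990), §4.9 (4.9.4) p. 56; §12.2 pp. 173–175; §12.5 p. 182.
* [vanDijk1972] G. van Dijk, *Computation of certain induced characters of 𝔭-adic groups*, Math. Ann. 199 (1972), Thm. p. 237.
* [HarishChandra1999] Harish-Chandra (notes by S. DeBacker, P. J. Sally), *Admissible Invariant Distributions on Reductive p-adic Groups*, ULS 16 (1999), Thm. 16.1 p. 77.
-/

set_option autoImplicit false
-- the mandated namespace has the single-problem summit's repeated segment (`HodgeConjecture.HodgeConjecture`)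
set_option linter.dupNamespace false

noncomputable section

open MeasureTheory Measure Set Filter Topology NumberField IsDedekindDomain
open Literature.NumberTheory.Automorphic Literature.NumberTheory.Automorphic.UnitaryGroup Literature.NumberTheory.Rogawski1990
open scoped MatrixGroups
open Summit.HodgeConjecture.HodgeConjecture.Cruxes.H413.K2E3CharLocIntPrincipalSeriesThree (exists_locallyIntegrable_smoothTrace_cmPrincipalSeries_eq)

namespace Summit.HodgeConjecture.HodgeConjecture.Cruxes.H413.K2E3CharLocIntNearSemisimpleCmPrincipalSeriesThree

/-! ## §1 The character of the module `i_G(χ)` is integrable near every point -/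

set_option maxHeartbeats 400000 in
/-- **THE CHARACTER OF `cmPrincipalSeries L 3 v χ` IS AN INTEGRABLE FUNCTION NEAR EVERY `s ∈ U(Φ₃)(L⁺_v)`** (`v` non-split, `χ` continuous, any Haar `μ`; the module may be reducible): there are
an open `U ∋ s` and `Θ` integrable on `U` with `Tr i_G(χ)(f) = ∫ f·Θ dμ` for every `f ∈ C_c^∞(G)` with `tsupport f ⊆ U` — ★ van Dijk `exists_locallyIntegrable_smoothTrace_cmPrincipalSeries_eq` (global
`L¹_loc` character of the MODULE), `U :=` the interior of a compact neighbourhood of `s`. [cite: Rogawski1990, §4.9 (4.9.4) p. 56; §12.5 p. 182] [cite: vanDijk1972, Thm. p. 237]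
[cite: HarishChandra1999, Thm. 16.1 p. 77] -/
theorem charLocIntNear_cmPrincipalSeries_three (L : Type) [Field L] [NumberField L] [IsCMField L] (v : HeightOneSpectrum (𝓞 ↥(maximalRealSubfield L)))
    (hns : ∀ w : PlacesOver L v, IsCMField.complexConj L • w.1 = w.1)
    [MeasurableSpace (Gqs L v)] [BorelSpace (Gqs L v)] (μ : Measure (Gqs L v)) [μ.IsHaarMeasure]
    (χ : ↥(cmBorelTriple L 3 v).M →* ℂˣ) (hχ : Continuous fun t => ((χ t : ℂˣ) : ℂ)) (s : Gqs L v) :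
    ∃ U : Set (Gqs L v), IsOpen U ∧ s ∈ U ∧
      ∃ Θ : Gqs L v → ℂ, IntegrableOn Θ U μ ∧
        ∀ f : Gqs L v → ℂ, f ∈ SchwartzBruhat (Gqs L v) → tsupport f ⊆ U →
          Representation.smoothTrace (G := Gqs L v) (UnitaryGroup.cmPrincipalSeries L 3 v χ) μ f = ∫ g, f g * Θ g ∂μ := by
  haveI : LocallyCompactSpace (Gqs L v) := locallyCompactSpace_local (IsCMField.complexConj L) 3 _ v
  obtain ⟨Θ, hΘ, htr⟩ := exists_locallyIntegrable_smoothTrace_cmPrincipalSeries_eq L v hns μ χ hχ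
  obtain ⟨K, hK, hKs⟩ := exists_compact_mem_nhds s
  exact ⟨interior K, isOpen_interior, mem_interior_iff_mem_nhds.2 hKs, Θ, (hΘ.integrableOn_isCompact hK).mono_set interior_subset,
    fun f hf _ => htr f hf.1 hf.2⟩

/-! ## §2 The ∀-closed socket shape (the `hrep₃` letter of the (11-3ns-res) reduction) -/

/-- **THE `hrep₃` LETTER, ∀-CLOSED** — ★ p860946's `hrep` bytes with `2 ↦ 3` (`Gqs L v` spelling, MAIN :945) and MAIN :953's semisimplicity binder after `∀ s` (unused: §1 holds at every
`s`). [cite: Rogawski1990, §4.9 (4.9.4) p. 56; §12.2 pp. 173–175] [cite: HarishChandra1999, Thm. 16.1 p. 77] -/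
theorem sig_shape_cmPrincipalSeries_three :
    ∀ (L : Type) [Field L] [NumberField L] [IsCMField L] (v : HeightOneSpectrum (𝓞 ↥(maximalRealSubfield L))),
      (∀ w : PlacesOver L v, IsCMField.complexConj L • w.1 = w.1) →
      ∀ [MeasurableSpace (Gqs L v)] [BorelSpace (Gqs L v)] (μ : Measure (Gqs L v)) [μ.IsHaarMeasure]
        (χ : ↥(cmBorelTriple L 3 v).M →* ℂˣ), Continuous (fun t => ((χ t : ℂˣ) : ℂ)) →
      ∀ s : Gqs L v, Module.End.IsSemisimple (Matrix.toLin' ((s.val : GL (Fin 3) (UnitaryGroup.LocalRing L v)).val : Matrix (Fin 3) (Fin 3) (UnitaryGroup.LocalRing L v))) →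
        ∃ U : Set (Gqs L v), IsOpen U ∧ s ∈ U ∧
          ∃ Θ : Gqs L v → ℂ, IntegrableOn Θ U μ ∧
            ∀ f : Gqs L v → ℂ, f ∈ SchwartzBruhat (Gqs L v) → tsupport f ⊆ U →
              Representation.smoothTrace (G := Gqs L v) (UnitaryGroup.cmPrincipalSeries L 3 v χ) μ f = ∫ g, f g * Θ g ∂μ := by
  intro L _ _ _ v hns _ _ μ _ χ hχ s _
  exact charLocIntNear_cmPrincipalSeries_three L v hns μ χ hχ s

end Summit.HodgeConjecture.HodgeConjecture.Cruxes.H413.K2E3CharLocIntNearSemisimpleCmPrincipalSeriesThree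

end
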